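import Summits.AnomalousDissipation.AnomalousDissipation.Theorems.BaireTransferRobustLoudUpgradeStubLscInterior
import Summits.AnomalousDissipation.AnomalousDissipation.Theorems.BaireTransferRobustLoudUpgradeStubDriftWeakOfClassical
import Summits.AnomalousDissipation.AnomalousDissipation.Theorems.BaireTransferRobustLoudUpgradeStubDriftRegularity
import Summits.AnomalousDissipation.AnomalousDissipation.Theorems.BaireTransferRobustLoudUpgradeStubDriftClassicalOfWeak

/-!
# Stub `stub_driftLscInterior` of the line `malkin-cone-group-orbits`
# (crux stmt-AnomalousDissipation-1144, lead c15, wave 4): generic persistence at a point of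
# lower hemicontinuity of the DRIFTED steady correspondence (steady witnesses of ANY mean)

At a coefficient vector `c ∈ P_S` where the drifted steady correspondence of the stratum `n`,
`Φₙ(c') = {(ν, m, W) : ν ∈ [1/(n+1), n], ‖m‖ ≤ n, ‖∇W‖² ≤ n², W ∈ H a drifted steady weak solution of
NS_ν(f_{c'}) with drift m}` (drifted weak identity
`⟨F_{ν,f_{c'}}(W), φ⟩ + ∫ ⟪Dφ(x) m, W(x)⟫ dx = 0` for all `φ ∈ 𝒱`), is LOWER hemicontinuous, every
classical steady witness `(ν, u, p)` of `c` of ANY mean inside the stratum (`1/(n+1) ≤ ν ≤ n`,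
`‖∫ u‖ ≤ n`, `‖∇u‖² ≤ n²`) with strict budgets (`meanEnergy < E`, `meanDissipation > ε`) at a
viscosity `ν ∈ (0,a)` makes `c` an INTERIOR point of `loud S a E ε`.

Proof (the any-mean copy of `Category.stub_lscInterior`).  (1) The classical witness gives a point
`(ν, m, W)`, `m = ∫ u`, of `Φₙ(c)` (`Category.stub_driftWeakOfClassical`) with
`‖m‖² + ‖W‖² = meanEnergy < E` and `(W, f_c) = meanDissipation > ε`; the enstrophy constraint
`‖∇W‖² ≤ n²` follows from `meanDissipation = ν‖∇W‖² = ν‖∇u‖²` and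
`gradNormSq = eGradNormSq.toReal` on smooth fields.  (2) The set
`O = (0,a) × {(m', W') : ‖m'‖² + ‖W'‖² < E, ε + δ < ⟪W', f_c⟫}` (`2δ` = the dissipation slack) is
open in `ℝ × ℝ³ × H` and meets `Φₙ(c)`.  (3) Lower hemicontinuity: `Φₙ(c') ∩ O ≠ ∅` for `c'` near
`c`; continuity of `c' ↦ f_{c'}` in `L²` (`continuous_toLp_force`) and Cauchy–Schwarz on the ball
`‖W'‖ < √E` move `⟪W', f_{c'}⟫` by less than `δ`.  (4) A point `(ν', m', W') ∈ Φₙ(c') ∩ O` has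
`W' ∈ V` (finite enstrophy), a smooth representative `v` (`Category.stub_driftRegularity`), and
`m' + v` is a classical steady state of `NS_{ν'}(f_{c'})` with `meanEnergy = ‖m'‖² + ‖W'‖² < E` and
`meanDissipation = (W', f_{c'}) > ε` (`Category.stub_driftClassicalOfWeak`): a `1`-periodic loud
witness of `c'`.
-/

-- `Summit.<Summit>.<Problem>` is the tree's mandated summit-side namespace (CONVENTIONS §2); for this
-- single-conjunct summit the two coincide, so the duplicate is deliberate.
set_option linter.dupNamespace false

noncomputable section

open scoped BigOperators Topology InnerProductSpace RealInnerProductSpace ENNReal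
open Filter Set Function TopologicalSpace MeasureTheory

namespace Summit.AnomalousDissipation.AnomalousDissipation.Theorems.RobustLoudUpgrade.Category

open Literature.Analysis.FunctionSpaces Literature.Analysis.FunctionSpaces.Torus
open Literature.Analysis.FluidPDE Literature.Analysis.FluidPDE.Torus
open Summit.AnomalousDissipation.AnomalousDissipation.Theses.BaireTransfer
open Summit.AnomalousDissipation.AnomalousDissipation.Theorems.DenseLoudDesignerForces
open Summit.AnomalousDissipation.AnomalousDissipation.Theorems.RobustLoudUpgrade.CensusInterior

namespace DriftLsc

/-! ## §1 A classical witness of any mean in the stratum is a point of the drifted correspondence -/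

/-- A classical steady state `(u, p)` of `NS_ν(f_c)` (`ν > 0`) of ANY mean `m = ∫ u` with `‖∇u‖² ≤ n²`
gives a drifted steady weak solution `W ∈ V` with drift `m`, `‖∇W‖² ≤ n²` (in `ℝ≥0∞`),
`meanEnergy = ‖m‖² + ‖W‖²` and `meanDissipation = (W, f_c)`: `Category.stub_driftWeakOfClassical`, the
identity `meanDissipation = ν‖∇W‖² = ν‖∇u‖²` and `gradNormSq u = (eGradNormSq u).toReal` for smooth
`u`. [folklore] -/
theorem exists_driftWeak_of_isSteadyNSState_of_gradNormSq_le {S : Finset (Fin 3 → ℤ)} {c : Coeff S}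
    {n : ℕ} {ν : ℝ} {u : UnitAddTorus (Fin 3) → EuclideanSpace ℝ (Fin 3)}
    {p : UnitAddTorus (Fin 3) → ℝ} (hν : 0 < ν) (hst : Torus.IsSteadyNSState ν (force S c) u p)
    (hg : gradNormSq u ≤ (n : ℝ) ^ 2) :
    ∃ W : energySpace (Fin 3), W.1 ∈ energySpaceV (Fin 3) ∧
      (∀ w : UnitAddTorus (Fin 3) → EuclideanSpace ℝ (Fin 3), IsSmooth w → IsDivFree w →
        HasZeroMean w →
        Torus.nsGeneratorPairing ν (force S c) W w +
          ∫ x, ⟪Torus.fderiv w x (∫ y, u y),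
            (W.1 : UnitAddTorus (Fin 3) → EuclideanSpace ℝ (Fin 3)) x⟫_ℝ = 0) ∧
      eGradNormSq (W.1 : UnitAddTorus (Fin 3) → EuclideanSpace ℝ (Fin 3)) ≤
          ENNReal.ofReal ((n : ℝ) ^ 2) ∧
        meanEnergy (fun _ : ℝ => u) = ‖∫ y, u y‖ ^ 2 + ‖W‖ ^ 2 ∧
          meanDissipation ν (fun _ : ℝ => u) = pairing W.1 (force S c) := by
  obtain ⟨W, hV, hW, hE, hD1, hD2⟩ :=
    stub_driftWeakOfClassical ν (force S c) u p hν (isSmooth_force c) hst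
  refine ⟨W, hV, hW, ?_, hE, hD2⟩
  have hu : IsSmooth u := hst.smooth_velocity.isSmooth_slice (mem_univ 0)
  have hfin : eGradNormSq (W.1 : UnitAddTorus (Fin 3) → EuclideanSpace ℝ (Fin 3)) ≠ ⊤ :=
    hV.2.eGradNormSq_lt_top.ne
  -- `meanDissipation = ν‖∇u‖²` (one period) `= ν‖∇W‖²` (the drift carries no enstrophy)
  have h1 : meanDissipation ν (fun _ : ℝ => u) = ν * (eGradNormSq u).toReal := by
    rw [meanDissipation_eq_of_periodic (τ := 1) (fun _ => rfl) one_pos]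
    simp
  have h3 : (eGradNormSq (W.1 : UnitAddTorus (Fin 3) → EuclideanSpace ℝ (Fin 3))).toReal =
      gradNormSq u := by
    rw [gradNormSq_eq_toReal_eGradNormSq_holds hu]
    exact mul_left_cancel₀ hν.ne' (by rw [← hD1, h1])
  rw [← ENNReal.ofReal_toReal hfin, h3]
  exact ENNReal.ofReal_le_ofReal hg

end DriftLsc

open DriftLsc

/-! ## §2 The stub -/

/-- **stub_driftLscInterior** (registered sub-goal, c15 wave 4).  At a point `c` of LOWER
hemicontinuity of the drifted steady correspondence of the stratum `n`, a classical steady witness of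
`c` of ANY mean INSIDE the stratum (`1/(n+1) ≤ ν ≤ n`, `‖∫ u‖ ≤ n`, `‖∇u‖² ≤ n²`) with STRICT budgets
(`meanEnergy < E`, `meanDissipation > ε`) at a viscosity `ν ∈ (0,a)` makes `c` an interior point of
`loud S a E ε`: nearby forces carry nearby drifted steady weak solutions at nearby viscosities and
drifts (lower hemicontinuity), whose classical representatives (`Category.stub_driftRegularity`,
`Category.stub_driftClassicalOfWeak`) have nearby budgets. [folklore] -/
theorem stub_driftLscInterior : ∀ (S : Finset (Fin 3 → ℤ)) (n : ℕ) (a E ε : ℝ) (c : Coeff S),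
    LowerHemicontinuousAt (fun c' : Coeff S =>
      {q : ℝ × EuclideanSpace ℝ (Fin 3) × energySpace (Fin 3) | 1 / ((n : ℝ) + 1) ≤ q.1 ∧ q.1 ≤ (n : ℝ) ∧ ‖q.2.1‖ ≤ (n : ℝ) ∧
        eGradNormSq (q.2.2.1 : UnitAddTorus (Fin 3) → EuclideanSpace ℝ (Fin 3)) ≤ ENNReal.ofReal ((n : ℝ) ^ 2) ∧
        ∀ w : UnitAddTorus (Fin 3) → EuclideanSpace ℝ (Fin 3), IsSmooth w → IsDivFree w → HasZeroMean w →
          Torus.nsGeneratorPairing q.1 (force S c') q.2.2 w +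
            ∫ x, ⟪Torus.fderiv w x q.2.1, (q.2.2.1 : UnitAddTorus (Fin 3) → EuclideanSpace ℝ (Fin 3)) x⟫_ℝ = 0}) c →
    (∃ ν : ℝ, 0 < ν ∧ ν < a ∧ 1 / ((n : ℝ) + 1) ≤ ν ∧ ν ≤ (n : ℝ) ∧
      ∃ (u : UnitAddTorus (Fin 3) → EuclideanSpace ℝ (Fin 3)) (p : UnitAddTorus (Fin 3) → ℝ),
        Torus.IsSteadyNSState ν (force S c) u p ∧ ‖∫ y, u y‖ ≤ (n : ℝ) ∧ gradNormSq u ≤ (n : ℝ) ^ 2 ∧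
          meanEnergy (fun _ : ℝ => u) < E ∧ ε < meanDissipation ν (fun _ : ℝ => u)) →
    c ∈ interior (loud S a E ε) := by
  intro S n a E ε c hlsc hwit
  obtain ⟨ν, hν, hνa, hν1, hν2, u, p, hst, hm, hg, hE, hD⟩ := hwit
  -- (1) the witness as a point `(ν, ∫ u, W)` of the drifted correspondence, with strict budgets
  obtain ⟨W, -, hWw, hWg, hWE, hWD⟩ := exists_driftWeak_of_isSteadyNSState_of_gradNormSq_le hν hst hg
  set F := fun c' : Coeff S => (memLp_force c').toLp (force S c')
  rw [hWE] at hE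
  rw [hWD, pairing_eq_inner (memLp_force c)] at hD
  -- (2) the open set `O = (0,a) × {‖m'‖² + ‖W'‖² < E, ε + δ < ⟪W', f_c⟫}` meets `Φₙ(c)` at `(ν, ∫ u, W)`
  obtain ⟨δ, hδ, hδD⟩ : ∃ δ : ℝ, 0 < δ ∧ ε + δ + δ < ⟪W.1, F c⟫_ℝ :=
    ⟨(⟪W.1, F c⟫_ℝ - ε) / 3, by linarith, by linarith⟩
  set O : Set (ℝ × EuclideanSpace ℝ (Fin 3) × energySpace (Fin 3)) :=
    Ioo 0 a ×ˢ ({q : EuclideanSpace ℝ (Fin 3) × energySpace (Fin 3) | ‖q.1‖ ^ 2 + ‖q.2‖ ^ 2 < E} ∩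
      {q : EuclideanSpace ℝ (Fin 3) × energySpace (Fin 3) | ε + δ < ⟪q.2.1, F c⟫_ℝ}) with hO
  have hOo : IsOpen O :=
    isOpen_Ioo.prod ((isOpen_lt ((continuous_fst.norm.pow 2).add (continuous_snd.norm.pow 2))
      continuous_const).inter (isOpen_lt continuous_const
        ((continuous_subtype_val.comp continuous_snd).inner continuous_const)))
  have hWδ : ε + δ < ⟪W.1, F c⟫_ℝ := by linarith
  have hνW : ((fun c' : Coeff S =>
      {q : ℝ × EuclideanSpace ℝ (Fin 3) × energySpace (Fin 3) | 1 / ((n : ℝ) + 1) ≤ q.1 ∧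
        q.1 ≤ (n : ℝ) ∧ ‖q.2.1‖ ≤ (n : ℝ) ∧
        eGradNormSq (q.2.2.1 : UnitAddTorus (Fin 3) → EuclideanSpace ℝ (Fin 3)) ≤
            ENNReal.ofReal ((n : ℝ) ^ 2) ∧
        ∀ w : UnitAddTorus (Fin 3) → EuclideanSpace ℝ (Fin 3), IsSmooth w → IsDivFree w →
          HasZeroMean w →
          Torus.nsGeneratorPairing q.1 (force S c') q.2.2 w +
            ∫ x, ⟪Torus.fderiv w x q.2.1,
              (q.2.2.1 : UnitAddTorus (Fin 3) → EuclideanSpace ℝ (Fin 3)) x⟫_ℝ = 0}) c ∩ O).Nonempty :=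
    ⟨(ν, ∫ y, u y, W), ⟨hν1, hν2, hm, hWg, hWw⟩, Set.mk_mem_prod ⟨hν, hνa⟩ ⟨hE, hWδ⟩⟩
  -- (3) lower hemicontinuity at `c`, and continuity of `c' ↦ f_{c'}` in `L²`
  have h1 := (lowerHemicontinuousAt_iff.1 hlsc) O hOo hνW
  have hη : 0 < δ / (Real.sqrt E + 1) := by positivity
  have h2 : ∀ᶠ c' in 𝓝 c, dist (F c') (F c) < δ / (Real.sqrt E + 1) :=
    Metric.tendsto_nhds.1 ((continuous_toLp_force S).tendsto c) _ hη
  -- (4) every nearby `c'` is loud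
  rw [mem_interior_iff_mem_nhds]
  filter_upwards [h1, h2] with c' hc1 hc2
  obtain ⟨⟨ν', m', W'⟩, ⟨-, -, -, hW'g, hW'w⟩, hW'O⟩ := hc1
  simp only [hO, Set.mem_prod, Set.mem_Ioo, Set.mem_inter_iff, Set.mem_setOf_eq] at hW'O
  dsimp only at hW'g hW'w
  obtain ⟨⟨hν'0, hν'a⟩, hW'E, hW'D⟩ := hW'O
  have hVV : W'.1 ∈ energySpaceV (Fin 3) := ⟨W'.2, memSobolev_one_complexify_of_eGradNormSq_ne_top
    (Lp.memLp _) (ne_top_of_le_ne_top ENNReal.ofReal_ne_top hW'g)⟩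
  obtain ⟨v, hv, hae⟩ :=
    stub_driftRegularity ν' m' (force S c') W' hν'0 (isSmooth_force c') hVV hW'w
  obtain ⟨q, hqst, -, -, hvE, hvD⟩ := stub_driftClassicalOfWeak ν' m' (force S c') W' v hν'0
    (isSmooth_force c') (hasZeroMean_force c') hVV hW'w hv hae
  refine ⟨ν', hν'0, hν'a, 1, fun _ => fun x => m' + v x, fun _ => q, one_pos, hqst, fun _ => rfl,
    ?_, ?_⟩
  · rw [hvE]
    exact hW'E.le
  · rw [hvD, pairing_eq_inner (memLp_force c')]
    -- `⟪W', f_{c'}⟫ ≥ ⟪W', f_c⟫ − ‖W'‖‖f_{c'} − f_c‖ > (ε + δ) − δ`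
    have hcs : |⟪W'.1, F c'⟫_ℝ - ⟪W'.1, F c⟫_ℝ| ≤ ‖W'‖ * ‖F c' - F c‖ := by
      rw [← inner_sub_right, Submodule.coe_norm]
      exact abs_real_inner_le_norm _ _
    have hW'2 : ‖W'‖ ^ 2 < E := by linarith [sq_nonneg ‖m'‖]
    have hW'n : ‖W'‖ < Real.sqrt E := Real.lt_sqrt_of_sq_lt hW'2
    have hlt : ‖W'‖ * ‖F c' - F c‖ < δ := by
      rw [dist_eq_norm] at hc2
      calc ‖W'‖ * ‖F c' - F c‖ ≤ ‖W'‖ * (δ / (Real.sqrt E + 1)) :=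
            mul_le_mul_of_nonneg_left hc2.le (norm_nonneg _)
        _ < (Real.sqrt E + 1) * (δ / (Real.sqrt E + 1)) :=
            mul_lt_mul_of_pos_right (by linarith [Real.sqrt_nonneg E]) hη
        _ = δ := by field_simp
    have hab := (abs_le.1 hcs).1
    show ε ≤ ⟪W'.1, F c'⟫_ℝ
    linarith

end Summit.AnomalousDissipation.AnomalousDissipation.Theorems.RobustLoudUpgrade.Category

end
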